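import Literature.NumberTheory.PAdicHodge.BdRPlusDVR
import Literature.NumberTheory.PAdicHodge.BdRPlusGalois
import Literature.NumberTheory.PAdicHodge.FontaineOmega
import HarnessLib

/-!
# `θ : B_dR⁺(F) → ℂ_F`, units of `B_dR⁺(F)`, and the uniformizer `u = [ε] − 1`

Let `F` be a nonarchimedean local field of characteristic `0` and residue characteristic `p`.
Building on `BdRPlusDVR` (`B_dR⁺(F)` is a complete DVR with uniformizer `ξ`), `BdRPlusGalois`
(the `Γ_F`-action) and `FontaineOmega` (`u = ξ·c` with `θ(c) ≠ 0`):

* `thetaLoc : 𝔸_inf(F)[1/p] → ℂ_F`, `θ(x/pⁿ) = θ(x)/pⁿ`, with kernel `ker θ[1/p]`, `Γ_F`-equivariant;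
* `thetaBdR : B_dR⁺(F) → ℂ_F` (**Fontaine's `θ` on `B_dR⁺`**): surjective (`thetaBdR_surjective`),
  kernel `= ξ B_dR⁺ =` the maximal ideal (`ker_thetaBdR_eq_span`), extending `θ`
  (`thetaBdR_algebraMap_algebraMap`), and `Γ_F`-equivariant (`thetaBdR_galBdRPlus`);
* **units**: `IsUnit b ↔ θ(b) ≠ 0` (`isUnit_iff_thetaBdR_ne_zero`);
* **`u = [ε] − 1` is a uniformizer of `B_dR⁺(F)`**: `u_dR = ξ_dR · (unit)` (`exists_uBdR_eq_xiBdR_mul`),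
  `maximalIdeal = (u_dR)` (`maximalIdeal_bDeRhamPlus_eq_span_uBdR`);
* **Tate twist**: `σ(u_dR) = k_σ · u_dR` with `θ(k_σ) = θ(χ(σ))`, `χ` the cyclotomic character viewed
  in `𝔸_inf` via `ℤ_p → 𝔸_inf` (`exists_galBdRPlus_uBdR_eq_mul`), from
  `[ε^{χ(σ)}] − 1 ≡ χ(σ)·u (mod ξ²)` (file `CyclotomicTilt`).

This is Fontaine 1994, Exp. II §1.5.2–1.5.5 (`gr¹ B_dR = ℂ_F(1)`), Fontaine–Ouyang §5.1.2.

## References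
* [FontaineAsterisque223III] J.-M. Fontaine, *Le corps des périodes p-adiques*, Astérisque 223
  (1994), Exp. II, §1.5.
* [FontaineOuyang2022] J.-M. Fontaine, Y. Ouyang, *Theory of p-adic Galois representations*
  (book draft), §5.1.
-/

noncomputable section

open ValuativeRel Field Ideal WittVector UniformSpace
open Literature.AlgebraicGeometry.Resolution

namespace Literature.NumberTheory.PAdicHodge

open Literature.NumberTheory.GaloisRepresentations
open Literature.NumberTheory.GaloisRepresentations.IsNonarchimedeanLocalField

variable {F : Type} [Field F] [ValuativeRel F] [TopologicalSpace F] [IsNonarchimedeanLocalField F]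
  [CharZero F] {p : ℕ} [Fact p.Prime] [Fact (¬ IsUnit (p : integerC F))]
  [IsAdicComplete (Ideal.span {(p : integerC F)}) (integerC F)]

/-! ### `θ` with `p` inverted, valued in `ℂ_F` -/

/-- Powers of `p` map to units of `ℂ_F` under `θ` (`char F = 0`). [folklore] -/
theorem isUnit_subtype_fontaineTheta_powers (y : Submonoid.powers (p : Ainf (p := p) F)) :
    IsUnit (((integerC F).subtype.comp (fontaineTheta (integerC F) p)) y) := by
  obtain ⟨_, n, rfl⟩ := y
  rw [RingHom.comp_apply, map_pow, map_natCast, map_pow, map_natCast]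
  exact isUnit_iff_ne_zero.2 (pow_ne_zero _ (natCast_C_ne_zero (Fact.out : p.Prime).ne_zero))

/-- **`θ_ℂ : 𝔸_inf(F)[1/p] → ℂ_F`**, `x/pⁿ ↦ θ(x)/pⁿ`. [cite: FontaineAsterisque223III, Exp. II §1.5.2] -/
def thetaLoc : Localization.Away (p : Ainf (p := p) F) →+* CompletedAlgClosure F :=
  IsLocalization.lift (M := Submonoid.powers (p : Ainf (p := p) F))
    (g := (integerC F).subtype.comp (fontaineTheta (integerC F) p)) isUnit_subtype_fontaineTheta_powers

/-- `θ_ℂ` extends `θ`. [folklore] -/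
@[simp] theorem thetaLoc_algebraMap (x : Ainf (p := p) F) :
    thetaLoc (algebraMap (Ainf (p := p) F) (Localization.Away (p : Ainf (p := p) F)) x) =
      ((fontaineTheta (integerC F) p x : integerC F) : CompletedAlgClosure F) := by
  rw [thetaLoc, IsLocalization.lift_eq]; rfl

/-- `θ_ℂ` on fractions: `θ_ℂ(x/pⁿ) = θ(x)/pⁿ`. [folklore] -/
theorem thetaLoc_mk' (x : Ainf (p := p) F) (n : ℕ) :
    thetaLoc (IsLocalization.mk' (Localization.Away (p : Ainf (p := p) F)) x
        (⟨(p : Ainf (p := p) F) ^ n, n, rfl⟩ : Submonoid.powers (p : Ainf (p := p) F))) =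
      ((fontaineTheta (integerC F) p x : integerC F) : CompletedAlgClosure F) / (p : CompletedAlgClosure F) ^ n := by
  have hp0 : (p : CompletedAlgClosure F) ^ n ≠ 0 := pow_ne_zero _ (natCast_C_ne_zero (Fact.out : p.Prime).ne_zero)
  rw [thetaLoc, IsLocalization.lift_mk'_spec]
  change ((fontaineTheta (integerC F) p x : integerC F) : CompletedAlgClosure F) =
    ((fontaineTheta (integerC F) p ((p : Ainf (p := p) F) ^ n) : integerC F) : CompletedAlgClosure F) * _
  rw [map_pow, map_natCast, SubmonoidClass.coe_pow, coe_natCast_integerC, mul_div_cancel₀ _ hp0]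

/-- **`ker θ_ℂ = ker θ[1/p]`** (`= (ξ)`). [cite: FontaineAsterisque223III, Exp. II §1.5.2] -/
theorem ker_thetaLoc_eq : RingHom.ker (thetaLoc (F := F) (p := p)) = RingHom.ker (fontaineThetaInvertP (integerC F) p) := by
  ext z
  obtain ⟨⟨x, ⟨_, n, rfl⟩⟩, rfl⟩ := IsLocalization.mk'_surjective (Submonoid.powers (p : Ainf (p := p) F)) z
  have hp0 : (p : CompletedAlgClosure F) ^ n ≠ 0 := pow_ne_zero _ (natCast_C_ne_zero (Fact.out : p.Prime).ne_zero)
  rw [RingHom.mem_ker, RingHom.mem_ker]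
  change thetaLoc (IsLocalization.mk' _ x (⟨(p : Ainf (p := p) F) ^ n, n, rfl⟩ : Submonoid.powers (p : Ainf (p := p) F))) = 0 ↔
    fontaineThetaInvertP (integerC F) p (IsLocalization.mk' _ x (⟨(p : Ainf (p := p) F) ^ n, n, rfl⟩ : Submonoid.powers (p : Ainf (p := p) F))) = 0
  rw [thetaLoc_mk', fontaineThetaInvertP_mk', div_eq_zero_iff, IsLocalization.mk'_eq_zero_iff]
  constructor
  · rintro (h | h)
    · refine ⟨1, ?_⟩
      change ((1 : Submonoid.powers (p : integerC F)) : integerC F) * _ = 0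
      rw [OneMemClass.coe_one, one_mul]
      exact Subtype.ext h
    · exact absurd h hp0
  · rintro ⟨⟨_, k, rfl⟩, hk⟩
    left
    change (p : integerC F) ^ k * fontaineTheta (integerC F) p x = 0 at hk
    have hx : fontaineTheta (integerC F) p x = 0 := by
      induction k with
      | zero => rwa [pow_zero, one_mul] at hk
      | succ k ih => rw [pow_succ', mul_assoc] at hk; exact ih (eq_zero_of_natCast_mul_eq_zero hk)
    rw [hx]; rfl

/-- **`θ_ℂ` is `Γ_F`-equivariant.** [cite: FontaineAsterisque223III, Exp. II §1.5.2] -/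
theorem thetaLoc_galAinfLoc (σ : absoluteGaloisGroup F) (z : Localization.Away (p : Ainf (p := p) F)) :
    thetaLoc (galAinfLoc σ z) = σ • thetaLoc z := by
  have h : (thetaLoc (F := F) (p := p)).comp (galAinfLoc σ) = (CompletedAlgClosure.galRingHom σ).comp thetaLoc := by
    refine IsLocalization.ringHom_ext (Submonoid.powers (p : Ainf (p := p) F)) (RingHom.ext fun y => ?_)
    simp only [RingHom.coe_comp, Function.comp_apply]
    rw [galAinfLoc_algebraMap, thetaLoc_algebraMap, thetaLoc_algebraMap, fontaineTheta_galAinf, coe_galInt,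
      CompletedAlgClosure.smul_def]
  exact RingHom.congr_fun h z

/-! ### `θ` on `B_dR⁺` -/

/-- `ker θ[1/p] ≤ ker θ_ℂ` (they are equal). [folklore] -/
theorem ker_le_ker_thetaLoc : ∀ a ∈ RingHom.ker (fontaineThetaInvertP (integerC F) p), thetaLoc (F := F) (p := p) a = 0 :=
  fun a ha => by rw [← RingHom.mem_ker, ker_thetaLoc_eq]; exact ha

/-- **Fontaine's `θ : B_dR⁺(F) → ℂ_F`**: `B_dR⁺ → B_dR⁺/(ker θ[1/p]) = 𝔸_inf[1/p]/(ker θ[1/p]) → ℂ_F`.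
[cite: FontaineAsterisque223III, Exp. II §1.5.2] [cite: FontaineOuyang2022, §5.1.1] -/
def thetaBdR : BDeRhamPlus (integerC F) p →+* CompletedAlgClosure F :=
  (Ideal.Quotient.lift (RingHom.ker (fontaineThetaInvertP (integerC F) p)) thetaLoc ker_le_ker_thetaLoc).comp
    (AdicCompletion.evalOneₐ (RingHom.ker (fontaineThetaInvertP (integerC F) p))).toRingHom

/-- `θ` on `B_dR⁺` in terms of `evalOneₐ`. [folklore] -/
theorem thetaBdR_apply (b : BDeRhamPlus (integerC F) p) :
    thetaBdR b = Ideal.Quotient.lift (RingHom.ker (fontaineThetaInvertP (integerC F) p)) thetaLoc ker_le_ker_thetaLoc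
      (AdicCompletion.evalOneₐ (RingHom.ker (fontaineThetaInvertP (integerC F) p)) b) := rfl

/-- **`θ` on `B_dR⁺` extends `θ_ℂ`** along `𝔸_inf[1/p] → B_dR⁺`. [cite: FontaineAsterisque223III, Exp. II §1.5.2] -/
@[simp] theorem thetaBdR_algebraMap (z : Localization.Away (p : Ainf (p := p) F)) :
    thetaBdR (algebraMap (Localization.Away (p : Ainf (p := p) F)) (BDeRhamPlus (integerC F) p) z) = thetaLoc z := by
  rw [thetaBdR_apply, algebraMap_bDeRhamPlus_apply, AdicCompletion.evalOneₐ_of, Ideal.Quotient.lift_mk]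

/-- **`θ` on `B_dR⁺` extends `θ`.** [cite: FontaineAsterisque223III, Exp. II §1.5.2] -/
theorem thetaBdR_algebraMap_algebraMap (x : Ainf (p := p) F) :
    thetaBdR (algebraMap (Localization.Away (p : Ainf (p := p) F)) (BDeRhamPlus (integerC F) p)
      (algebraMap (Ainf (p := p) F) (Localization.Away (p : Ainf (p := p) F)) x)) =
      ((fontaineTheta (integerC F) p x : integerC F) : CompletedAlgClosure F) := by
  rw [thetaBdR_algebraMap, thetaLoc_algebraMap]

/-- `θ(ξ_dR) = 0`. [folklore] -/
theorem thetaBdR_xiBdR : thetaBdR (xiBdR : BDeRhamPlus (integerC F) p) = 0 := by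
  rw [xiBdR, thetaBdR_algebraMap_algebraMap, fontaineTheta_xi]; rfl

/-- **`θ : B_dR⁺ → ℂ_F` is surjective** (given the surjectivity of `θ`; `ℂ_F = 𝒪_{ℂ_F}[1/p]`).
[cite: FontaineAsterisque223III, Exp. II §1.5.2] -/
theorem thetaBdR_surjective (hF : Function.Surjective (fontaineTheta (integerC F) p)) :
    Function.Surjective (thetaBdR (F := F) (p := p)) := by
  intro c
  obtain ⟨⟨y, ⟨_, n, rfl⟩⟩, hc⟩ := IsLocalization.surj (Submonoid.powers (p : integerC F)) c
  obtain ⟨x, rfl⟩ := hF y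
  refine ⟨algebraMap _ _ (IsLocalization.mk' (Localization.Away (p : Ainf (p := p) F)) x
    (⟨(p : Ainf (p := p) F) ^ n, n, rfl⟩ : Submonoid.powers (p : Ainf (p := p) F))), ?_⟩
  rw [thetaBdR_algebraMap, thetaLoc_mk']
  have hp0 : (p : CompletedAlgClosure F) ^ n ≠ 0 := pow_ne_zero _ (natCast_C_ne_zero (Fact.out : p.Prime).ne_zero)
  rw [div_eq_iff hp0]
  change c * algebraMap (integerC F) (CompletedAlgClosure F) ((p : integerC F) ^ n) =
    algebraMap (integerC F) (CompletedAlgClosure F) (fontaineTheta (integerC F) p x) at hc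
  rw [map_pow, map_natCast] at hc
  exact hc.symm

/-- The extended ideal `(ker θ[1/p]) B_dR⁺` is `(ξ_dR)`. [folklore] -/
theorem map_ker_eq_span_xiBdR :
    (RingHom.ker (fontaineThetaInvertP (integerC F) p)).map
        (algebraMap (Localization.Away (p : Ainf (p := p) F)) (BDeRhamPlus (integerC F) p)) =
      Ideal.span {(xiBdR : BDeRhamPlus (integerC F) p)} :=
  PrincipalCompletion.map_eq_span ker_fontaineThetaInvertP_eq_span

/-- `θ` vanishes on `(ξ_dR)`. [folklore] -/
theorem thetaBdR_eq_zero_of_mem_span {b : BDeRhamPlus (integerC F) p}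
    (hb : b ∈ Ideal.span {(xiBdR : BDeRhamPlus (integerC F) p)}) : thetaBdR b = 0 := by
  obtain ⟨c, rfl⟩ := Ideal.mem_span_singleton'.1 hb
  rw [map_mul, thetaBdR_xiBdR, mul_zero]

set_option maxHeartbeats 800000 in
/-- `b − (lift of b mod ker θ[1/p])` lies in the extended ideal (stated on Mathlib's `AdicCompletion`). [folklore] -/
theorem sub_of_mem_map {b : AdicCompletion (RingHom.ker (fontaineThetaInvertP (integerC F) p)) (Localization.Away (p : Ainf (p := p) F))}
    {z : Localization.Away (p : Ainf (p := p) F)}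
    (hz : AdicCompletion.evalOneₐ (RingHom.ker (fontaineThetaInvertP (integerC F) p)) b = Ideal.Quotient.mk _ z) :
    b - AdicCompletion.of (RingHom.ker (fontaineThetaInvertP (integerC F) p)) (Localization.Away (p : Ainf (p := p) F)) z ∈
      (RingHom.ker (fontaineThetaInvertP (integerC F) p)).map
        (algebraMap (Localization.Away (p : Ainf (p := p) F))
          (AdicCompletion (RingHom.ker (fontaineThetaInvertP (integerC F) p)) (Localization.Away (p : Ainf (p := p) F)))) := by
  rw [← AdicCompletion.ker_evalOneₐ_eq_map _ fg_ker_fontaineThetaInvertP, RingHom.mem_ker]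
  have h2 : AdicCompletion.evalOneₐ (RingHom.ker (fontaineThetaInvertP (integerC F) p))
      (AdicCompletion.of (RingHom.ker (fontaineThetaInvertP (integerC F) p)) (Localization.Away (p : Ainf (p := p) F)) z) =
        Ideal.Quotient.mk _ z :=
    AdicCompletion.evalOneₐ_of _ z
  change AdicCompletion.evalOneₐ (RingHom.ker (fontaineThetaInvertP (integerC F) p))
    (b - AdicCompletion.of (RingHom.ker (fontaineThetaInvertP (integerC F) p)) (Localization.Away (p : Ainf (p := p) F)) z) = 0
  rw [map_sub, hz, h2, sub_self]

/-- `b − (lift of b mod ξ)` lies in `(ξ_dR)`. [folklore] -/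
theorem sub_algebraMap_mem_span {b : BDeRhamPlus (integerC F) p} {z : Localization.Away (p : Ainf (p := p) F)}
    (hz : AdicCompletion.evalOneₐ (RingHom.ker (fontaineThetaInvertP (integerC F) p)) b = Ideal.Quotient.mk _ z) :
    b - algebraMap (Localization.Away (p : Ainf (p := p) F)) (BDeRhamPlus (integerC F) p) z ∈
      Ideal.span {(xiBdR : BDeRhamPlus (integerC F) p)} := by
  rw [← map_ker_eq_span_xiBdR]
  exact sub_of_mem_map hz

/-- **`ker θ = ξ B_dR⁺`** on `B_dR⁺`. [cite: FontaineAsterisque223III, Exp. II §1.5.2] -/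
theorem mem_ker_thetaBdR_iff (b : BDeRhamPlus (integerC F) p) :
    thetaBdR b = 0 ↔ b ∈ Ideal.span {(xiBdR : BDeRhamPlus (integerC F) p)} := by
  refine ⟨fun h => ?_, thetaBdR_eq_zero_of_mem_span⟩
  obtain ⟨z, hz⟩ := Ideal.Quotient.mk_surjective
    (AdicCompletion.evalOneₐ (RingHom.ker (fontaineThetaInvertP (integerC F) p)) b)
  have hmem := sub_algebraMap_mem_span hz.symm
  have hz0 : thetaLoc z = 0 := by
    rw [← thetaBdR_algebraMap (F := F) (p := p) z]
    have : algebraMap _ _ z = b - (b - algebraMap (Localization.Away (p : Ainf (p := p) F)) (BDeRhamPlus (integerC F) p) z) := by ring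
    rw [this, map_sub, h, thetaBdR_eq_zero_of_mem_span hmem, sub_zero]
  rw [← RingHom.mem_ker, ker_thetaLoc_eq] at hz0
  have hz1 : algebraMap (Localization.Away (p : Ainf (p := p) F)) (BDeRhamPlus (integerC F) p) z ∈
      Ideal.span {(xiBdR : BDeRhamPlus (integerC F) p)} := by
    rw [← map_ker_eq_span_xiBdR]; exact Ideal.mem_map_of_mem _ hz0
  have : b = (b - algebraMap _ _ z) + algebraMap (Localization.Away (p : Ainf (p := p) F)) (BDeRhamPlus (integerC F) p) z := by ring
  rw [this]
  exact Submodule.add_mem _ hmem hz1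

/-- `ker θ = span {ξ_dR}` as ideals of `B_dR⁺`. [cite: FontaineAsterisque223III, Exp. II §1.5.2] -/
theorem ker_thetaBdR_eq_span :
    RingHom.ker (thetaBdR (F := F) (p := p)) = Ideal.span {(xiBdR : BDeRhamPlus (integerC F) p)} := by
  ext b; rw [RingHom.mem_ker, mem_ker_thetaBdR_iff]

/-- **Units of `B_dR⁺`: `b` is a unit iff `θ(b) ≠ 0`.** [cite: FontaineOuyang2022, Prop. 5.1.4] -/
theorem isUnit_iff_thetaBdR_ne_zero (hF : Function.Surjective (fontaineTheta (integerC F) p))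
    (b : BDeRhamPlus (integerC F) p) : IsUnit b ↔ thetaBdR b ≠ 0 := by
  haveI := isLocalRing_bDeRhamPlus (F := F) (p := p) hF
  rw [← IsLocalRing.notMem_maximalIdeal, maximalIdeal_bDeRhamPlus_eq_span hF, ← mem_ker_thetaBdR_iff]

/-- An element of `𝔸_inf(F)` with `θ(x) ≠ 0` becomes a unit in `B_dR⁺`. [folklore] -/
theorem isUnit_algebraMap_of_fontaineTheta_ne_zero (hF : Function.Surjective (fontaineTheta (integerC F) p))
    {x : Ainf (p := p) F} (hx : fontaineTheta (integerC F) p x ≠ 0) :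
    IsUnit (algebraMap (Localization.Away (p : Ainf (p := p) F)) (BDeRhamPlus (integerC F) p)
      (algebraMap (Ainf (p := p) F) (Localization.Away (p : Ainf (p := p) F)) x)) := by
  rw [isUnit_iff_thetaBdR_ne_zero hF, thetaBdR_algebraMap_algebraMap]
  exact fun h => hx (Subtype.ext h)

/-- `Γ_F` preserves `(ξ_dR)`. [folklore] -/
theorem galBdRPlus_mem_span (σ : absoluteGaloisGroup F) {b : BDeRhamPlus (integerC F) p}
    (hb : b ∈ Ideal.span {(xiBdR : BDeRhamPlus (integerC F) p)}) :
    galBdRPlus σ b ∈ Ideal.span {(xiBdR : BDeRhamPlus (integerC F) p)} := by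
  rw [Ideal.mem_span_singleton'] at hb ⊢
  obtain ⟨c, rfl⟩ := hb
  -- `σ(ξ̃) ∈ ker θ[1/p] = (ξ̃)`
  have h1 : galAinfLoc σ (algebraMap (Ainf (p := p) F) (Localization.Away (p : Ainf (p := p) F)) xi) ∈
      RingHom.ker (fontaineThetaInvertP (integerC F) p) :=
    map_galAinfLoc_ker_le σ (Ideal.mem_map_of_mem _ (by
      rw [ker_fontaineThetaInvertP_eq_span]; exact Ideal.mem_span_singleton_self _))
  rw [ker_fontaineThetaInvertP_eq_span, Ideal.mem_span_singleton'] at h1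
  obtain ⟨d, hd⟩ := h1
  refine ⟨galBdRPlus σ c * algebraMap _ _ d, ?_⟩
  rw [map_mul]
  change _ = galBdRPlus σ c * galBdRPlus σ (AdicCompletion.of (RingHom.ker (fontaineThetaInvertP (integerC F) p)) (Localization.Away (p : Ainf (p := p) F))
    (algebraMap (Ainf (p := p) F) (Localization.Away (p : Ainf (p := p) F)) xi))
  rw [galBdRPlus_of, ← hd, ← algebraMap_bDeRhamPlus_apply, map_mul, mul_assoc]
  rfl

/-- **`θ` on `B_dR⁺` is `Γ_F`-equivariant.** [cite: FontaineAsterisque223III, Exp. II §1.5.2] -/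
theorem thetaBdR_galBdRPlus (σ : absoluteGaloisGroup F) (b : BDeRhamPlus (integerC F) p) :
    thetaBdR (galBdRPlus σ b) = σ • thetaBdR b := by
  obtain ⟨z, hz⟩ := Ideal.Quotient.mk_surjective
    (AdicCompletion.evalOneₐ (RingHom.ker (fontaineThetaInvertP (integerC F) p)) b)
  have hmem := sub_algebraMap_mem_span hz.symm
  obtain ⟨d, hd⟩ : ∃ d, d = b - algebraMap (Localization.Away (p : Ainf (p := p) F)) (BDeRhamPlus (integerC F) p) z := ⟨_, rfl⟩
  rw [← hd] at hmem
  have hb : b = algebraMap (Localization.Away (p : Ainf (p := p) F)) (BDeRhamPlus (integerC F) p) z + d := by rw [hd]; ring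
  rw [hb, map_add, map_add, map_add, thetaBdR_eq_zero_of_mem_span hmem, add_zero,
    thetaBdR_eq_zero_of_mem_span (galBdRPlus_mem_span σ hmem), add_zero, thetaBdR_algebraMap]
  change thetaBdR (galBdRPlus σ (AdicCompletion.of (RingHom.ker (fontaineThetaInvertP (integerC F) p)) (Localization.Away (p : Ainf (p := p) F)) z)) = _
  rw [galBdRPlus_of, ← algebraMap_bDeRhamPlus_apply, thetaBdR_algebraMap, thetaLoc_galAinfLoc]

/-- `θ (σ • b) = σ • θ b`. [cite: FontaineAsterisque223III, Exp. II §1.5.2] -/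
theorem thetaBdR_smul (σ : absoluteGaloisGroup F) (b : BDeRhamPlus (integerC F) p) :
    thetaBdR (σ • b) = σ • thetaBdR b :=
  thetaBdR_galBdRPlus σ b

/-! ### The uniformizer `u = [ε] − 1` -/

/-- **`u_dR`**: the image of `u = [ε] − 1` in `B_dR⁺(F)`. [cite: FontaineAsterisque223III, Exp. II §1.5.4] -/
def uBdR : BDeRhamPlus (integerC F) p :=
  algebraMap (Localization.Away (p : Ainf (p := p) F)) (BDeRhamPlus (integerC F) p)
    (algebraMap (Ainf (p := p) F) (Localization.Away (p : Ainf (p := p) F)) uAinf)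

/-- The composite `𝔸_inf → B_dR⁺` as a ring map. [folklore] -/
abbrev ainfToBdR : Ainf (p := p) F →+* BDeRhamPlus (integerC F) p :=
  (algebraMap (Localization.Away (p : Ainf (p := p) F)) (BDeRhamPlus (integerC F) p)).comp
    (algebraMap (Ainf (p := p) F) (Localization.Away (p : Ainf (p := p) F)))

omit [CharZero F] in
/-- `ainfToBdR ξ = ξ_dR`. [folklore] -/
theorem ainfToBdR_xi : ainfToBdR (xi : Ainf (p := p) F) = xiBdR := rfl

/-- `ainfToBdR u = u_dR`. [folklore] -/
theorem ainfToBdR_uAinf : ainfToBdR (uAinf : Ainf (p := p) F) = uBdR := rfl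

/-- `θ ∘ ainfToBdR = θ`. [folklore] -/
theorem thetaBdR_ainfToBdR (x : Ainf (p := p) F) :
    thetaBdR (ainfToBdR x) = ((fontaineTheta (integerC F) p x : integerC F) : CompletedAlgClosure F) :=
  thetaBdR_algebraMap_algebraMap x

/-- `σ ∘ ainfToBdR = ainfToBdR ∘ 𝕎(σ♭)`. [folklore] -/
theorem galBdRPlus_ainfToBdR (σ : absoluteGaloisGroup F) (x : Ainf (p := p) F) :
    galBdRPlus σ (ainfToBdR x) = ainfToBdR (galAinf σ x) := by
  unfold ainfToBdR
  rw [RingHom.comp_apply, RingHom.comp_apply, algebraMap_bDeRhamPlus_apply, algebraMap_bDeRhamPlus_apply, galBdRPlus_of,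
    galAinfLoc_algebraMap]

/-- **`u_dR = ξ_dR · v` with `v` a unit**: `u = [ε] − 1` is a uniformizer of `B_dR⁺(F)`.
[cite: FontaineAsterisque223III, Exp. II §1.5.4] [cite: FontaineOuyang2022, Prop. 5.1.6] -/
theorem exists_uBdR_eq_xiBdR_mul (hF : Function.Surjective (fontaineTheta (integerC F) p)) :
    ∃ v : BDeRhamPlus (integerC F) p, IsUnit v ∧ uBdR = xiBdR * v := by
  obtain ⟨c, hc, hθ⟩ := exists_uAinf_eq_xi_mul (F := F) (p := p)
  refine ⟨ainfToBdR c, isUnit_algebraMap_of_fontaineTheta_ne_zero hF hθ, ?_⟩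
  rw [← ainfToBdR_uAinf, hc, map_mul, ainfToBdR_xi]

/-- **The maximal ideal of `B_dR⁺(F)` is generated by `u_dR = [ε] − 1`.** [cite: FontaineAsterisque223III, Exp. II §1.5.4] -/
theorem maximalIdeal_bDeRhamPlus_eq_span_uBdR (hF : Function.Surjective (fontaineTheta (integerC F) p)) :
    haveI := isLocalRing_bDeRhamPlus (F := F) (p := p) hF
    IsLocalRing.maximalIdeal (BDeRhamPlus (integerC F) p) = Ideal.span {(uBdR : BDeRhamPlus (integerC F) p)} := by
  obtain ⟨v, hv, huv⟩ := exists_uBdR_eq_xiBdR_mul (F := F) (p := p) hF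
  rw [maximalIdeal_bDeRhamPlus_eq_span hF, huv]
  exact (Ideal.span_singleton_mul_right_unit hv _).symm

/-! ### The Tate twist: `σ(u) = k_σ u`, `θ(k_σ) = θ(χ(σ))` -/

/-- **`σ(u_dR) − χ(σ)·u_dR ∈ ξ² B_dR⁺`** (image of `[ε^{χ(σ)}] − 1 ≡ χ(σ) u (mod ξ²𝔸_inf)`).
[cite: FontaineAsterisque223III, Exp. II §1.5.4] -/
theorem galBdRPlus_uBdR_sub_mem (σ : absoluteGaloisGroup F) :
    galBdRPlus σ (uBdR : BDeRhamPlus (integerC F) p) -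
        ainfToBdR (zpToAinf ((GaloisRep.cyclotomicCharacter F p σ : ℤ_[p]ˣ) : ℤ_[p])) * uBdR ∈
      Ideal.span {(xiBdR : BDeRhamPlus (integerC F) p) ^ 2} := by
  have h := teichmuller_epsPow_sub_one_sub_mem (F := F) (p := p) ((GaloisRep.cyclotomicCharacter F p σ : ℤ_[p]ˣ) : ℤ_[p])
  obtain ⟨c, hc⟩ := Ideal.mem_span_singleton'.1 h
  refine Ideal.mem_span_singleton'.2 ⟨ainfToBdR c, ?_⟩
  rw [← ainfToBdR_uAinf, galBdRPlus_ainfToBdR, galAinf_uAinf, ← ainfToBdR_xi, ← map_pow, ← map_mul, hc]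
  simp only [map_sub, map_one, map_mul]

/-- **`σ(u_dR) = k_σ · u_dR` with `θ(k_σ) = θ(χ(σ))`** (so `Γ_F` acts on `gr¹ B_dR⁺ = ℂ_F · ū` through
`χ`: `gr¹ B_dR ≅ ℂ_F(1)`). [cite: FontaineAsterisque223III, Exp. II §1.5.4–1.5.5] [cite: FontaineOuyang2022, §5.1.2] -/
theorem exists_galBdRPlus_uBdR_eq_mul (hF : Function.Surjective (fontaineTheta (integerC F) p)) (σ : absoluteGaloisGroup F) :
    ∃ k : BDeRhamPlus (integerC F) p, galBdRPlus σ uBdR = k * uBdR ∧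
      thetaBdR k = ((fontaineTheta (integerC F) p (zpToAinf ((GaloisRep.cyclotomicCharacter F p σ : ℤ_[p]ˣ) : ℤ_[p])) :
        integerC F) : CompletedAlgClosure F) := by
  obtain ⟨v, hv, huv⟩ := exists_uBdR_eq_xiBdR_mul (F := F) (p := p) hF
  obtain ⟨c, hc⟩ := Ideal.mem_span_singleton'.1 (galBdRPlus_uBdR_sub_mem (F := F) (p := p) σ)
  -- `ξ² = u · (ξ v⁻¹)`
  obtain ⟨w, hw⟩ := hv
  refine ⟨ainfToBdR (zpToAinf ((GaloisRep.cyclotomicCharacter F p σ : ℤ_[p]ˣ) : ℤ_[p])) +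
    c * (xiBdR * ((w⁻¹ : (BDeRhamPlus (integerC F) p)ˣ) : BDeRhamPlus (integerC F) p)), ?_, ?_⟩
  · have h1 : galBdRPlus σ uBdR = ainfToBdR (zpToAinf ((GaloisRep.cyclotomicCharacter F p σ : ℤ_[p]ˣ) : ℤ_[p])) * uBdR +
        c * xiBdR ^ 2 := by linear_combination -hc
    rw [h1, huv, ← hw]
    have hw1 : ((w⁻¹ : (BDeRhamPlus (integerC F) p)ˣ) : BDeRhamPlus (integerC F) p) * (w : BDeRhamPlus (integerC F) p) = 1 :=
      Units.inv_mul w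
    linear_combination (-(c * xiBdR ^ 2)) * hw1
  · rw [map_add, thetaBdR_ainfToBdR, map_mul, map_mul, thetaBdR_xiBdR, zero_mul, mul_zero, add_zero]

end Literature.NumberTheory.PAdicHodge

end
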